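import Mathlib
import Summits.Ventures.HodgeRepro2.T5OpenUnitsLevel

/-!
# The higher unit groups are open in `O_{Kv}ˣ`: unit-level characters trivial on `U^n` are
  continuous

`T5OpenUnitsLevel` shows that the image of `U^n = higherUnits π n` in `Kvˣ` is open. Pulling
back along the continuous inclusion `ι : O_{Kv}ˣ → Kvˣ` (injective, so `ι⁻¹(ι(U^n)) = U^n`)
gives the same at the level of the units of the ring of integers — the level at which
`T5ConductorExistence` / `T5AdicCompletionInert` / `T5AdicCompletionRamified` produce their
characters:

* `isOpen_higherUnits`: `U^n` (`n ≥ 1`) is an open subgroup of `O_{Kv}ˣ`;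
* `continuous_of_eq_one_on_higherUnits`: a homomorphism `O_{Kv}ˣ →* M` trivial on `U^n` is
  continuous — so the characters of `T5AdicCompletionRamified.exists_character_exact_even_level_of_quadratic_ramified`
  and `T5AdicCompletionInert.exists_character_exact_level_of_quadratic_inert` are continuous
  (`exists_continuous_character_exact_even_level_of_quadratic_ramified`).

Declaration per README §8(d): «uses an L-value-free non-vanishing device: NO».
-/

namespace Summit.Ventures.HodgeRepro2.T5OpenUnitsIntegers

open T5PrincipalUnitFiltration T5PrincipalUnitComparison IsDedekindDomain HeightOneSpectrum

section General

variable {R : Type*} [CommRing R] [IsDedekindDomain R] {K : Type*} [Field K] [Algebra R K]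
  [IsFractionRing R K] (v : HeightOneSpectrum R)

/-- The inclusion of the integral units into `Kvˣ` is continuous. -/
theorem continuous_unitsMapK :
    Continuous (Units.map (algebraMap (adicCompletionIntegers K v) (adicCompletion K v) :
      adicCompletionIntegers K v →* adicCompletion K v)) :=
  Units.continuous_map continuous_subtype_val

/-- `U^n` (`n ≥ 1`) is an OPEN subgroup of `O_{Kv}ˣ`. -/
theorem isOpen_higherUnits {π : adicCompletionIntegers K v} (hπ : Irreducible π) {n : ℕ}
    (hn : 1 ≤ n) : IsOpen ((higherUnits π n : Subgroup (adicCompletionIntegers K v)ˣ) :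
      Set (adicCompletionIntegers K v)ˣ) := by
  have hinj : Function.Injective (Units.map (algebraMap (adicCompletionIntegers K v)
      (adicCompletion K v) : adicCompletionIntegers K v →* adicCompletion K v)) :=
    Units.map_injective Subtype.val_injective
  have e : ((higherUnits π n : Subgroup (adicCompletionIntegers K v)ˣ) :
      Set (adicCompletionIntegers K v)ˣ) =
      (Units.map (algebraMap (adicCompletionIntegers K v) (adicCompletion K v) :
        adicCompletionIntegers K v →* adicCompletion K v)) ⁻¹'
        (((higherUnits π n).map (Units.map (algebraMap (adicCompletionIntegers K v)
          (adicCompletion K v) : adicCompletionIntegers K v →* adicCompletion K v)) :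
          Subgroup (adicCompletion K v)ˣ) : Set (adicCompletion K v)ˣ) := by
    rw [Subgroup.coe_map, Set.preimage_image_eq _ hinj]
  rw [e]
  exact (T5OpenUnitsLevel.isOpen_map_higherUnits v hπ hn).preimage (continuous_unitsMapK v)

/-- A homomorphism `O_{Kv}ˣ →* M` trivial on `U^n` (`n ≥ 1`) is continuous. -/
theorem continuous_of_eq_one_on_higherUnits {M : Type*} [MulOneClass M] [TopologicalSpace M]
    [ContinuousMul M] {π : adicCompletionIntegers K v} (hπ : Irreducible π) {n : ℕ} (hn : 1 ≤ n)
    (χ : (adicCompletionIntegers K v)ˣ →* M) (h : ∀ s ∈ higherUnits π n, χ s = 1) :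
    Continuous χ := by
  -- the ring of integers is a topological ring as a subring of `Kv` (the `ValuationSubring`
  -- coercion does not carry the instance by itself)
  haveI : ContinuousMul (adicCompletionIntegers K v) :=
    inferInstanceAs (ContinuousMul (adicCompletionIntegers K v).toSubring)
  exact T5ProfiniteCharacterExtension.continuous_of_eq_one_on_open_subgroup χ _
    (isOpen_higherUnits v hπ hn) h

end General

section Concrete

variable {K : Type*} [Field K] [NumberField K] (v : HeightOneSpectrum (NumberField.RingOfIntegers K))
variable {L : Type*} [Field L] [NumberField L] [Algebra K L]
  (w : HeightOneSpectrum (NumberField.RingOfIntegers L))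
variable [Algebra (adicCompletion K v) (adicCompletion L w)]
  [ContinuousSMul (adicCompletion K v) (adicCompletion L w)]
  [IsScalarTower K (adicCompletion K v) (adicCompletion L w)]

/-- At a RAMIFIED quadratic place, for every `k` a CONTINUOUS character of `O_{Lw}ˣ` trivial on
`U_E^{2k+2}` and on the image of `O_{Kv}ˣ`, non-trivial on `U_E^{2k+1}`. -/
theorem exists_continuous_character_exact_even_level_of_quadratic_ramified
    (hfin : Module.finrank (adicCompletion K v) (adicCompletion L w) = 2)
    {ϖ : adicCompletionIntegers K v} (hϖ : Irreducible ϖ) {π : adicCompletionIntegers L w}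
    (hπ : Irreducible π)
    (hram : ¬ Irreducible (algebraMap (adicCompletionIntegers K v) (adicCompletionIntegers L w) ϖ))
    (k : ℕ) :
    ∃ χ : (adicCompletionIntegers L w)ˣ →* ℂˣ, Continuous χ ∧
      (∀ y ∈ higherUnits π (2 * k + 2), χ y = 1) ∧
      (∀ r : (adicCompletionIntegers K v)ˣ, χ (unitsMap r) = 1) ∧
      ∃ y ∈ higherUnits π (2 * k + 1), χ y ≠ 1 := by
  obtain ⟨χ, h1, h2, h3⟩ :=
    T5AdicCompletionRamified.exists_character_exact_even_level_of_quadratic_ramified v w hfin hϖ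
      hπ hram k
  exact ⟨χ, continuous_of_eq_one_on_higherUnits w hπ (by omega) χ h1, h1, h2, h3⟩

/-- At an INERT quadratic place, for every `n ≥ 1` a CONTINUOUS character of `O_{Lw}ˣ` trivial on
`U_E^{n+1}` and on the image of `O_{Kv}ˣ`, non-trivial on `U_E^n`. -/
theorem exists_continuous_character_exact_level_of_quadratic_inert
    (hfin : Module.finrank (adicCompletion K v) (adicCompletion L w) = 2)
    {ϖ : adicCompletionIntegers K v} (hϖ : Irreducible ϖ)
    (hϖL : Irreducible (algebraMap (adicCompletionIntegers K v) (adicCompletionIntegers L w) ϖ))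
    {n : ℕ} (hn : 1 ≤ n) :
    ∃ χ : (adicCompletionIntegers L w)ˣ →* ℂˣ, Continuous χ ∧
      (∀ y ∈ higherUnits (algebraMap (adicCompletionIntegers K v) (adicCompletionIntegers L w) ϖ)
        (n + 1), χ y = 1) ∧
      (∀ r : (adicCompletionIntegers K v)ˣ, χ (unitsMap r) = 1) ∧
      ∃ y ∈ higherUnits (algebraMap (adicCompletionIntegers K v) (adicCompletionIntegers L w) ϖ) n,
        χ y ≠ 1 := by
  obtain ⟨χ, h1, h2, h3⟩ :=
    T5AdicCompletionInert.exists_character_exact_level_of_quadratic_inert v w hfin hϖ hϖL n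
  exact ⟨χ, continuous_of_eq_one_on_higherUnits w hϖL (n := n + 1) (by omega) χ h1, h1, h2, h3⟩

end Concrete

end Summit.Ventures.HodgeRepro2.T5OpenUnitsIntegers
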